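import Literature.AnabelianGeometry.SemiGraphs.FreeProPRankTwoTwistCores
import Literature.AnabelianGeometry.SemiGraphs.FreeProPRankTwoLevels
import Literature.AnabelianGeometry.SemiGraphs.FreeProPTwoSlimMalnormal
import Literature.AnabelianGeometry.SemiGraphs.FreeProPTwoEstrangementByAbelianisation
import Literature.AnabelianGeometry.AbsoluteAnabelian.ProfiniteAutGroup
import HarnessLib

/-!
# Conjugacy INTO the branch subgroups of `F̂₂⁽ᵖ⁾` is detected at a finite level, uniformly in the twist
# (typed-form audit of [SemiAnbd] Thm 3.7 (iv) clause 2 at `𝒢_θ`, row «B9·ANCHOR-FREE-PAIR», engine K-A)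

Mochizuki, *Semi-graphs of anabelioids*, Publ. RIMS **42** (2006) 221–322, §3, Theorem 3.7 (iv) p. 41
("the intersection of two distinct maximal compact subgroups is either trivial or an edge-like subgroup")
and Def. 2.4 (iv) p. 26 (estrangement of branch subgroups) [cite: MochizukiSemiAnbd2006, Thm 3.7(iv) p.41].

PROOF-ONLY file (abc-iut cell, layer L3, seat abc-iut-L3-d4 gen 5; row «B9·ANCHOR-FREE-PAIR@𝒢_θ» GO'd by
the L3 lead; frontier / erratum-grade label: it serves the typed-form audit of the cell's ∀-countable typing of
Thm 3.7 (iv) at abc-iut-L3-d1's countermodel `𝒢_θ(p,n)`, OUTSIDE the [IUTchIII] Cor. 3.12 cone; 0 definitions,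
no named fact).  Desk memo: `HOME/staging/L3/L3-d4/g5/B9-ANCHOR-FREE-PAIR.md` §1 (S0).

The two-level arguments at `𝒢_θ` (deep fixed points of a power `c^{p^m}` of the escaping element project onto
fixed points of `c`; min-heights of fixed trees of anchor-free elements escape) all reduce to ONE statement of
profinite group theory about the vertex group `G = F̂₂⁽ᵖ⁾ = ⟨a, b⟩` of brick R1 (abc-iut-w6-d019), its branch
subgroups `A = cl⟨a⟩` (`FreeProPRankTwo.A`) and `A_t = θ_t(A) = cl⟨a·b^{p^t}⟩` (`FreeProPRankTwo.An`), and
the characteristic open cores `G(d) = charOpenCore G d`: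

* `exists_nhds_one_forall_conj_mem_mul_imp` — GENERIC: in a compact topological group, if `M` is closed,
  `Y` compact and the open set `Ω` contains every `ε` conjugating some `y ∈ Y` into `M` (`ε⁻¹ y ε ∈ M`), then
  some neighbourhood `W` of `1` already has `ε⁻¹ y ε ∈ M·W ⇒ ε ∈ Ω` (one application of Mathlib's
  `compact_open_separated_mul_right` to the image of `Ωᶜ × Y` under `(ε, y) ↦ ε⁻¹ y ε`).
* `FreeProPRankTwo.mem_A_of_conj_mem_A`, `….mem_An_of_conj_mem_An` (malnormality, brick R2a, abc-iut-L3-t7: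
  `closure_zpowers_a_inf_conj_eq_bot`, `closure_zpowers_aMulPow_inf_conj_eq_bot'`),
  `FreeProPRankTwo.A_inf_conj_An_eq_bot` + the two «cross» vanishing statements (brick R2b, abc-iut-w6-d096:
  `PadicInt.inf_conj_topologicalClosure_zpowers_mul_pow_prime_pow_eq_bot_of_exponential`).
* `FreeProPRankTwo.exists_charOpenCore_conj_detection` — **THE ENGINE**: for every compact
  `Λ ⊆ ℤ_p ∖ {0}` and every open subgroup `V ≤ G` there is ONE characteristic open core `G(d)` such that for
  ALL twists `t` and all `λ ∈ Λ`, `ε ∈ G`: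
  (i) `ε⁻¹ a^λ ε ∈ A·G(d) ⇒ ε ∈ A·V`; (ii) `ε⁻¹ θ_t(a^λ) ε ∈ A_t·G(d) ⇒ ε ∈ A_t·V`;
  (iii) `ε⁻¹ θ_t(a^λ) ε ∈ A·G(d) ⇒ ε ∈ A_t·V`; (iv) `ε⁻¹ a^λ ε ∈ A_t·G(d) ⇒ ε ∈ A·V`
  — the uniformity in `t` from `θ_t → id` uniformly (brick R1b, `exists_forall_θ_mul_inv_mem`): beyond the
  threshold of the core found for (i) every clause reduces to (i); the finitely many small `t` are handled one
  by one, the cross clauses having EMPTY limit.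

Classical profinite group theory about R1's group; nothing of [SemiAnbd] is asserted or refuted here; nothing
bears on [IUTchIII] Cor. 3.12; desk ≠ kernel for B9 itself until file K-B lands; typed ≠ proved.
-/

namespace Literature.AnabelianGeometry.SemiGraphs

open Filter Topology
open scoped Pointwise

/-! ### Generic: conjugacy into a closed subgroup is detected by a neighbourhood of `1` -/

section Algebra

variable {G : Type*} [Group G]

/-- In a product `S·N` with `N` a NORMAL subgroup, `c·m·w ∈ S·N` whenever `m ∈ S` and `c, w ∈ N` (the
absorption step of the «large twist» reduction). [cite: MochizukiSemiAnbd2006, Thm 3.7(iv) p.41] -/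
theorem mul_mul_mem_coe_mul_of_normal {S N : Subgroup G} [hN : N.Normal] {m c w : G} (hm : m ∈ S)
    (hc : c ∈ N) (hw : w ∈ N) : c * m * w ∈ (S : Set G) * (N : Set G) :=
  ⟨m, hm, m⁻¹ * c * m * w, N.mul_mem (hN.conj_mem' c hc m) hw, by group⟩

end Algebra

section Generic

variable {G : Type*} [Group G] [TopologicalSpace G] [IsTopologicalGroup G] [CompactSpace G]

/-- **Conjugacy INTO a closed subset is detected by a neighbourhood of the identity** (compact groups): if
`M` is closed, `Y` compact, `Ω` open, and every `ε` with `ε⁻¹ y ε ∈ M` for some `y ∈ Y` lies in `Ω`, then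
for some `W ∈ 𝓝 1` already `ε⁻¹ y ε ∈ M·W` (`y ∈ Y`) forces `ε ∈ Ω` — the compactness step behind
«deep fixed points project onto fixed points» in the typed-form audit of Thm 3.7 (iv) at `𝒢_θ`
(classical; one application of `compact_open_separated_mul_right`). [cite: MochizukiSemiAnbd2006, Thm 3.7(iv) p.41] -/
theorem exists_nhds_one_forall_conj_mem_mul_imp {M : Set G} (hM : IsClosed M) {Y : Set G}
    (hY : IsCompact Y) {Ω : Set G} (hΩ : IsOpen Ω)
    (h : ∀ ε y, y ∈ Y → ε⁻¹ * y * ε ∈ M → ε ∈ Ω) :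
    ∃ W ∈ 𝓝 (1 : G), ∀ ε y, y ∈ Y → ε⁻¹ * y * ε ∈ M * W → ε ∈ Ω := by
  -- the compact set of «bad» pairs and its (compact) image under conjugation, disjoint from `M`
  set f : G × G → G := fun q => q.1⁻¹ * q.2 * q.1 with hf_def
  have hf : Continuous f := (continuous_fst.inv.mul continuous_snd).mul continuous_fst
  have hK : IsCompact (f '' (Ωᶜ ×ˢ Y)) := ((hΩ.isClosed_compl.isCompact).prod hY).image hf
  have hsub : f '' (Ωᶜ ×ˢ Y) ⊆ Mᶜ := by
    rintro _ ⟨⟨ε, y⟩, ⟨hε, hy⟩, rfl⟩ hm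
    exact hε (h ε y hy hm)
  obtain ⟨V, hV, hVsub⟩ := compact_open_separated_mul_right hK hM.isOpen_compl hsub
  refine ⟨V⁻¹, inv_mem_nhds_one G hV, fun ε y hy hmem => ?_⟩
  by_contra hε
  obtain ⟨m, hm, w, hw, hmw⟩ := Set.mem_mul.mp hmem
  have h1 : ε⁻¹ * y * ε * w⁻¹ ∈ f '' (Ωᶜ ×ˢ Y) * V :=
    Set.mul_mem_mul ⟨(ε, y), ⟨hε, hy⟩, rfl⟩ (Set.mem_inv.mp hw)
  have h2 : ε⁻¹ * y * ε * w⁻¹ = m := by rw [← hmw, mul_inv_cancel_right]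
  exact hVsub h1 (h2 ▸ hm)

end Generic

/-! ### The free pro-`p` group of rank two: malnormality and cross-estrangement as conjugacy statements -/

namespace FreeProPRankTwo

variable (p : ℕ)

/-- Unfolding `A p`. [cite: MochizukiSemiAnbd2006, Def 2.4(iv) p.26] -/
theorem mem_A_iff (x : Grp p) :
    x ∈ A p ↔ x ∈ (Subgroup.zpowers (ι p (FreeGroup.of 0))).topologicalClosure := Iff.rfl

/-- `a·b^{p^t} = ι (x₀·x₁^{p^t})`. [cite: MochizukiSemiAnbd2006, Def 2.4(iv) p.26] -/
theorem ι_of_zero_mul_of_one_pow (t : ℕ) :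
    ι p (FreeGroup.of 0 * FreeGroup.of 1 ^ (p ^ t)) = a p * b p ^ p ^ t := by
  rw [map_mul, map_pow]; rfl

/-- Unfolding `An p t`. [cite: MochizukiSemiAnbd2006, Def 2.4(iv) p.26] -/
theorem mem_An_iff (t : ℕ) (x : Grp p) :
    x ∈ An p t ↔ x ∈ (Subgroup.zpowers (ι p (FreeGroup.of 0 * FreeGroup.of 1 ^ (p ^ t)))).topologicalClosure := by
  rw [ι_of_zero_mul_of_one_pow]; rfl

/-- Conjugating back: `ε (ε⁻¹ y ε) ε⁻¹ = y`. [folklore] -/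
private theorem conj_conj_inv (ε y : Grp p) : ε * (ε⁻¹ * y * ε) * ε⁻¹ = y := by group

/-- `(toConjAct ε⁻¹)⁻¹ • x = ε x ε⁻¹`. [folklore] -/
private theorem toConjAct_inv_inv_smul (ε x : Grp p) :
    (ConjAct.toConjAct ε⁻¹)⁻¹ • x = ε * x * ε⁻¹ := by
  rw [← map_inv, inv_inv, ConjAct.smul_def, ConjAct.ofConjAct_toConjAct]

/-- `(toConjAct ε)⁻¹ • x = ε⁻¹ x ε`. [folklore] -/
private theorem toConjAct_inv_smul (ε x : Grp p) :
    (ConjAct.toConjAct ε)⁻¹ • x = ε⁻¹ * x * ε := by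
  rw [← map_inv, ConjAct.smul_def, ConjAct.ofConjAct_toConjAct, inv_inv]

/-- **Malnormality of `A = cl⟨a⟩` as a conjugacy statement**: if `y ∈ A`, `y ≠ 1` and `ε⁻¹ y ε ∈ A`, then
`ε ∈ A` (brick R2a). [cite: MochizukiSemiAnbd2006, Def 2.4(iv) p.26] -/
theorem mem_A_of_conj_mem_A {y ε : Grp p} (hy : y ∈ A p) (hy1 : y ≠ 1) (h : ε⁻¹ * y * ε ∈ A p) :
    ε ∈ A p := by
  by_contra hε
  have hε' : ε⁻¹ ∉ A p := fun h' => hε (inv_inv ε ▸ (A p).inv_mem h')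
  have hbot := closure_zpowers_a_inf_conj_eq_bot (isProSigmaCompletion_ι p)
    ((mem_A_iff p _).not.mp hε')
  have hmem : ε⁻¹ * y * ε ∈ (Subgroup.zpowers (ι p (FreeGroup.of 0))).topologicalClosure ⊓
      ConjAct.toConjAct ε⁻¹ • (Subgroup.zpowers (ι p (FreeGroup.of 0))).topologicalClosure := by
    refine Subgroup.mem_inf.mpr ⟨(mem_A_iff p _).mp h, ?_⟩
    rw [Subgroup.mem_pointwise_smul_iff_inv_smul_mem, toConjAct_inv_inv_smul, conj_conj_inv]
    exact (mem_A_iff p _).mp hy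
  rw [hbot] at hmem
  exact hy1 ((conj_conj_inv p ε y).symm.trans (by rw [Subgroup.mem_bot.mp hmem, mul_one, mul_inv_cancel]))

/-- **Malnormality of `A_t = cl⟨a·b^{p^t}⟩` as a conjugacy statement** (brick R2a, Nielsen basis).
[cite: MochizukiSemiAnbd2006, Def 2.4(iv) p.26] -/
theorem mem_An_of_conj_mem_An {t : ℕ} {y ε : Grp p} (hy : y ∈ An p t) (hy1 : y ≠ 1)
    (h : ε⁻¹ * y * ε ∈ An p t) : ε ∈ An p t := by
  by_contra hε
  have hε' : ε⁻¹ ∉ An p t := fun h' => hε (inv_inv ε ▸ (An p t).inv_mem h')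
  have hbot := closure_zpowers_aMulPow_inf_conj_eq_bot' (isProSigmaCompletion_ι p) (p ^ t)
    ((mem_An_iff p t _).not.mp hε')
  have hmem : ε⁻¹ * y * ε ∈
      (Subgroup.zpowers (ι p (FreeGroup.of 0 * FreeGroup.of 1 ^ (p ^ t)))).topologicalClosure ⊓
      ConjAct.toConjAct ε⁻¹ •
        (Subgroup.zpowers (ι p (FreeGroup.of 0 * FreeGroup.of 1 ^ (p ^ t)))).topologicalClosure := by
    refine Subgroup.mem_inf.mpr ⟨(mem_An_iff p t _).mp h, ?_⟩
    rw [Subgroup.mem_pointwise_smul_iff_inv_smul_mem, toConjAct_inv_inv_smul, conj_conj_inv]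
    exact (mem_An_iff p t _).mp hy
  rw [hbot] at hmem
  exact hy1 ((conj_conj_inv p ε y).symm.trans (by rw [Subgroup.mem_bot.mp hmem, mul_one, mul_inv_cancel]))

variable [hp : Fact p.Prime]

/-- **Cross-estrangement `A ⊓ g•A_t = ⊥`** at R1's group (brick R2b with `hinj` discharged by the
`ℤ_p`-exponential `α`). [cite: MochizukiSemiAnbd2006, Def 2.4(iv) p.26] -/
theorem A_inf_conj_An_eq_bot (t : ℕ) (g : ConjAct (Grp p)) : A p ⊓ g • An p t = ⊥ := by
  have hrange : (Subgroup.zpowers (a p)).topologicalClosure ≤ (α p).toMonoidHom.range :=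
    le_of_eq (range_α p).symm
  exact FreeProPTwo.PadicInt.inf_conj_topologicalClosure_zpowers_mul_pow_prime_pow_eq_bot_of_exponential p
    (ab p).toMonoidHom (ab p).continuous (a := a p) (b := b p)
    (by show Multiplicative.toAdd (ab p (a p)) = (1, 0); rw [ab_a]; rfl)
    (by show Multiplicative.toAdd (ab p (b p)) = (0, 1); rw [ab_b]; rfl)
    (α p).toMonoidHom (α p).continuous (α_ofAdd_one p) hrange t g

/-- No non-trivial element of `A_t` is conjugate into `A`. [cite: MochizukiSemiAnbd2006, Def 2.4(iv) p.26] -/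
theorem eq_one_of_mem_An_of_conj_mem_A {t : ℕ} {y ε : Grp p} (hy : y ∈ An p t)
    (h : ε⁻¹ * y * ε ∈ A p) : y = 1 := by
  have hbot := A_inf_conj_An_eq_bot p t (ConjAct.toConjAct ε⁻¹)
  have hmem : ε⁻¹ * y * ε ∈ A p ⊓ ConjAct.toConjAct ε⁻¹ • An p t := by
    refine Subgroup.mem_inf.mpr ⟨h, ?_⟩
    rw [Subgroup.mem_pointwise_smul_iff_inv_smul_mem, toConjAct_inv_inv_smul, conj_conj_inv]
    exact hy
  rw [hbot] at hmem
  exact (conj_conj_inv p ε y).symm.trans (by rw [Subgroup.mem_bot.mp hmem, mul_one, mul_inv_cancel])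

/-- No non-trivial element of `A` is conjugate into `A_t`. [cite: MochizukiSemiAnbd2006, Def 2.4(iv) p.26] -/
theorem eq_one_of_mem_A_of_conj_mem_An {t : ℕ} {y ε : Grp p} (hy : y ∈ A p)
    (h : ε⁻¹ * y * ε ∈ An p t) : y = 1 := by
  have hbot := A_inf_conj_An_eq_bot p t (ConjAct.toConjAct ε)
  have hmem : y ∈ A p ⊓ ConjAct.toConjAct ε • An p t := by
    refine Subgroup.mem_inf.mpr ⟨hy, ?_⟩
    rw [Subgroup.mem_pointwise_smul_iff_inv_smul_mem, toConjAct_inv_smul]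
    exact h
  rw [hbot] at hmem
  exact Subgroup.mem_bot.mp hmem

/-- `α λ ≠ 1` for `λ ≠ 0` (injectivity of the `ℤ_p`-exponential of `a`). [cite: MochizukiSemiAnbd2006, Def 2.4(iv) p.26] -/
theorem α_ne_one {l : Multiplicative ℤ_[p]} (hl : l ≠ 1) : α p l ≠ 1 := fun h =>
  hl (α_injective p (h.trans (map_one (α p)).symm))

/-! ### The engine: one characteristic open core detecting conjugacy into the branch subgroups, all twists -/

/-- **Conjugacy INTO the branch subgroups of `F̂₂⁽ᵖ⁾` is detected at a finite level, uniformly in the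
twist.**  For every compact `Λ ⊆ ℤ_p` not containing `0` and every open subgroup `V` there is `d` such that,
with `G(d) = charOpenCore (Grp p) d`, for ALL `t` and all `λ ∈ Λ`, `ε`:
(i) `ε⁻¹ a^λ ε ∈ A·G(d) ⇒ ε ∈ A·V`; (ii) `ε⁻¹ θ_t(a^λ) ε ∈ A_t·G(d) ⇒ ε ∈ A_t·V`;
(iii) `ε⁻¹ θ_t(a^λ) ε ∈ A·G(d) ⇒ ε ∈ A_t·V`; (iv) `ε⁻¹ a^λ ε ∈ A_t·G(d) ⇒ ε ∈ A·V`.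
(Typed-form audit of [SemiAnbd] Thm 3.7 (iv) clause 2 at `𝒢_θ`: engine (S0) of the desk memo.)
[cite: MochizukiSemiAnbd2006, Thm 3.7(iv) p.41] -/
theorem exists_charOpenCore_conj_detection {Λ : Set (Multiplicative ℤ_[p])} (hΛ : IsCompact Λ)
    (hΛ1 : (1 : Multiplicative ℤ_[p]) ∉ Λ) (V : Subgroup (Grp p)) (hV : IsOpen (V : Set (Grp p))) :
    ∃ d : ℕ, ∀ (t : ℕ) (l : Multiplicative ℤ_[p]), l ∈ Λ → ∀ ε : Grp p,
      (ε⁻¹ * α p l * ε ∈ (A p : Set (Grp p)) * (charOpenCore (Grp p) d : Set (Grp p)) →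
          ε ∈ (A p : Set (Grp p)) * (V : Set (Grp p))) ∧
      (ε⁻¹ * θ p t (α p l) * ε ∈ (An p t : Set (Grp p)) * (charOpenCore (Grp p) d : Set (Grp p)) →
          ε ∈ (An p t : Set (Grp p)) * (V : Set (Grp p))) ∧
      (ε⁻¹ * θ p t (α p l) * ε ∈ (A p : Set (Grp p)) * (charOpenCore (Grp p) d : Set (Grp p)) →
          ε ∈ (An p t : Set (Grp p)) * (V : Set (Grp p))) ∧
      (ε⁻¹ * α p l * ε ∈ (An p t : Set (Grp p)) * (charOpenCore (Grp p) d : Set (Grp p)) →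
          ε ∈ (A p : Set (Grp p)) * (V : Set (Grp p))) := by
  classical
  -- topological bookkeeping
  have hAc : IsClosed (A p : Set (Grp p)) := Subgroup.isClosed_topologicalClosure _
  have hAnc : ∀ t, IsClosed (An p t : Set (Grp p)) := fun t => Subgroup.isClosed_topologicalClosure _
  have hY₀ : IsCompact (α p '' Λ) := hΛ.image (α p).continuous
  have hYt : ∀ t, IsCompact (θ p t '' (α p '' Λ)) := fun t => hY₀.image (θ p t).continuous
  have hαne : ∀ l ∈ Λ, α p l ≠ 1 := fun l hl => α_ne_one p (fun h => hΛ1 (h ▸ hl))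
  have hθαne : ∀ t, ∀ l ∈ Λ, θ p t (α p l) ≠ 1 := fun t l hl h =>
    hαne l hl ((θ p t).injective (h.trans (map_one (θ p t)).symm))
  have hVn : (V : Set (Grp p)) ∈ 𝓝 (1 : Grp p) := hV.mem_nhds V.one_mem
  have hAV : IsOpen ((A p : Set (Grp p)) * (V : Set (Grp p))) := hV.mul_left
  have hAnV : ∀ t, IsOpen ((An p t : Set (Grp p)) * (V : Set (Grp p))) := fun t => hV.mul_left
  -- Step 1: clause (i) alone
  obtain ⟨W₁, hW₁, h1⟩ := exists_nhds_one_forall_conj_mem_mul_imp hAc hY₀ hAV (fun ε y hy hm => by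
    obtain ⟨l, hl, rfl⟩ := hy
    exact ⟨ε, mem_A_of_conj_mem_A p (α_mem_A p l) (hαne l hl) hm, 1, V.one_mem, mul_one ε⟩)
  obtain ⟨d₁, hd₁⟩ := Literature.AnabelianGeometry.AbsoluteAnabelian.exists_charOpenCore_subset
    (G := Grp p) (Filter.inter_mem hW₁ hVn)
  haveI : (charOpenCore (Grp p) d₁).Normal := normal_charOpenCore p d₁
  -- Step 2: the uniformity threshold `τ`: `θ_t ≡ id mod G(d₁)` for `t ≥ τ`
  obtain ⟨τ, hτ⟩ := exists_forall_θ_mul_inv_mem p (charOpenCore (Grp p) d₁) (isOpen_charOpenCore p d₁)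
  -- Step 3: the finitely many small twists, one neighbourhood each for clauses (ii), (iii), (iv)
  have h2 : ∀ t, ∃ W ∈ 𝓝 (1 : Grp p), ∀ ε y, y ∈ θ p t '' (α p '' Λ) →
      ε⁻¹ * y * ε ∈ (An p t : Set (Grp p)) * W → ε ∈ (An p t : Set (Grp p)) * (V : Set (Grp p)) :=
    fun t => exists_nhds_one_forall_conj_mem_mul_imp (hAnc t) (hYt t) (hAnV t) (fun ε y hy hm => by
      obtain ⟨_, ⟨l, hl, rfl⟩, rfl⟩ := hy
      exact ⟨ε, mem_An_of_conj_mem_An p (θ_α_mem_An p t l) (hθαne t l hl) hm, 1, V.one_mem, mul_one ε⟩)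
  have h3 : ∀ t, ∃ W ∈ 𝓝 (1 : Grp p), ∀ ε y, y ∈ θ p t '' (α p '' Λ) →
      ε⁻¹ * y * ε ∈ (A p : Set (Grp p)) * W → ε ∈ (∅ : Set (Grp p)) :=
    fun t => exists_nhds_one_forall_conj_mem_mul_imp hAc (hYt t) isOpen_empty (fun ε y hy hm => by
      obtain ⟨_, ⟨l, hl, rfl⟩, rfl⟩ := hy
      exact absurd (eq_one_of_mem_An_of_conj_mem_A p (θ_α_mem_An p t l) hm) (hθαne t l hl))
  have h4 : ∀ t, ∃ W ∈ 𝓝 (1 : Grp p), ∀ ε y, y ∈ α p '' Λ →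
      ε⁻¹ * y * ε ∈ (An p t : Set (Grp p)) * W → ε ∈ (∅ : Set (Grp p)) :=
    fun t => exists_nhds_one_forall_conj_mem_mul_imp (hAnc t) hY₀ isOpen_empty (fun ε y hy hm => by
      obtain ⟨l, hl, rfl⟩ := hy
      exact absurd (eq_one_of_mem_A_of_conj_mem_An p (α_mem_A p l) hm) (hαne l hl))
  choose W₂ hW₂ hW₂' using h2
  choose W₃ hW₃ hW₃' using h3
  choose W₄ hW₄ hW₄' using h4
  -- Step 4: one core below everything
  have hWall : (charOpenCore (Grp p) d₁ : Set (Grp p)) ∩ ⋂ t ∈ Finset.range τ, (W₂ t ∩ W₃ t ∩ W₄ t) ∈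
      𝓝 (1 : Grp p) := by
    refine Filter.inter_mem ((isOpen_charOpenCore p d₁).mem_nhds (charOpenCore (Grp p) d₁).one_mem) ?_
    exact (Filter.biInter_finset_mem (Finset.range τ)).mpr fun t _ =>
      Filter.inter_mem (Filter.inter_mem (hW₂ t) (hW₃ t)) (hW₄ t)
  obtain ⟨d, hd⟩ := Literature.AnabelianGeometry.AbsoluteAnabelian.exists_charOpenCore_subset
    (G := Grp p) hWall
  -- monotonicity helpers
  have hd_d₁ : (charOpenCore (Grp p) d : Set (Grp p)) ⊆ charOpenCore (Grp p) d₁ := fun x hx => (hd hx).1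
  have hd_small : ∀ t, t < τ → (charOpenCore (Grp p) d : Set (Grp p)) ⊆ W₂ t ∩ W₃ t ∩ W₄ t := by
    intro t ht x hx
    have hx' := (hd hx).2
    exact (Set.mem_iInter₂.mp hx') t (Finset.mem_range.mpr ht)
  have hd₁W₁ : (charOpenCore (Grp p) d₁ : Set (Grp p)) ⊆ W₁ := fun x hx => (hd₁ hx).1
  have hd₁V : (charOpenCore (Grp p) d₁ : Set (Grp p)) ⊆ V := fun x hx => (hd₁ hx).2
  -- the reduction of the large twists to clause (i)
  have hstep1 : ∀ ε, ∀ l ∈ Λ, ε⁻¹ * α p l * ε ∈ (A p : Set (Grp p)) * (charOpenCore (Grp p) d₁ : Set (Grp p)) →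
      ε ∈ (A p : Set (Grp p)) * (V : Set (Grp p)) := fun ε l hl hm =>
    h1 ε (α p l) ⟨l, hl, rfl⟩ (Set.mul_subset_mul_left hd₁W₁ hm)
  have hAsub : ∀ t, τ ≤ t → (A p : Set (Grp p)) * (V : Set (Grp p)) ⊆ (An p t : Set (Grp p)) * V := by
    rintro t ht _ ⟨a₀, ha₀, v, hv, rfl⟩
    refine ⟨θ p t a₀, ?_, (θ p t a₀)⁻¹ * a₀ * v, V.mul_mem ?_ hv, by group⟩
    · rw [An_eq_map_A]; exact ⟨a₀, ha₀, rfl⟩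
    · apply hd₁V
      have hc := hτ t ht a₀
      have : (θ p t a₀)⁻¹ * a₀ = (θ p t a₀)⁻¹ * (θ p t a₀ * a₀⁻¹)⁻¹ * (θ p t a₀) := by group
      rw [this]
      exact (normal_charOpenCore p d₁).conj_mem' _ ((charOpenCore (Grp p) d₁).inv_mem hc) _
  refine ⟨d, fun t l hl ε => ⟨?_, ?_, ?_, ?_⟩⟩
  · -- (i)
    exact fun hm => hstep1 ε l hl (Set.mul_subset_mul_left hd_d₁ hm)
  · -- (ii)
    intro hm
    rcases Nat.lt_or_ge t τ with ht | ht
    · exact hW₂' t ε _ ⟨α p l, ⟨l, hl, rfl⟩, rfl⟩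
        (Set.mul_subset_mul_left (fun x hx => ((hd_small t ht hx).1).1) hm)
    · obtain ⟨m, hm', w, hw, hmw⟩ := Set.mem_mul.mp (Set.mul_subset_mul_left hd_d₁ hm)
      rw [An_eq_map_A] at hm'
      obtain ⟨m₀, hm₀, rfl⟩ := hm'
      apply hAsub t ht
      apply hstep1 ε l hl
      -- `ε⁻¹ a^λ ε = (ε⁻¹ c⁻¹ ε)·(c' m₀)·w` with `c = θ(a^λ)(a^λ)⁻¹`, `c' = θ(m₀) m₀⁻¹` in the core
      have hc := hτ t ht (α p l)
      have hc' := hτ t ht m₀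
      have key : ε⁻¹ * α p l * ε =
          (ε⁻¹ * (θ p t (α p l) * (α p l)⁻¹)⁻¹ * ε * (θ p t m₀ * m₀⁻¹)) * m₀ * w := by
        have e : ε⁻¹ * θ p t (α p l) * ε = (θ p t).toMonoidHom m₀ * w := hmw.symm
        change ε⁻¹ * θ p t (α p l) * ε = θ p t m₀ * w at e
        calc ε⁻¹ * α p l * ε
            = ε⁻¹ * (θ p t (α p l) * (α p l)⁻¹)⁻¹ * ε * (ε⁻¹ * θ p t (α p l) * ε) := by group
          _ = ε⁻¹ * (θ p t (α p l) * (α p l)⁻¹)⁻¹ * ε * (θ p t m₀ * w) := by rw [e]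
          _ = _ := by group
      rw [key]
      refine mul_mul_mem_coe_mul_of_normal hm₀ ?_ hw
      exact (charOpenCore (Grp p) d₁).mul_mem
        ((normal_charOpenCore p d₁).conj_mem' _ ((charOpenCore (Grp p) d₁).inv_mem hc) _) hc'
  · -- (iii)
    intro hm
    rcases Nat.lt_or_ge t τ with ht | ht
    · exact absurd (hW₃' t ε _ ⟨α p l, ⟨l, hl, rfl⟩, rfl⟩
        (Set.mul_subset_mul_left (fun x hx => ((hd_small t ht hx).1).2) hm)) (Set.notMem_empty ε)
    · obtain ⟨m₀, hm₀, w, hw, hmw⟩ := Set.mem_mul.mp (Set.mul_subset_mul_left hd_d₁ hm)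
      apply hAsub t ht
      apply hstep1 ε l hl
      have hc := hτ t ht (α p l)
      have key : ε⁻¹ * α p l * ε = (ε⁻¹ * (θ p t (α p l) * (α p l)⁻¹)⁻¹ * ε) * m₀ * w := by
        calc ε⁻¹ * α p l * ε
            = ε⁻¹ * (θ p t (α p l) * (α p l)⁻¹)⁻¹ * ε * (ε⁻¹ * θ p t (α p l) * ε) := by group
          _ = ε⁻¹ * (θ p t (α p l) * (α p l)⁻¹)⁻¹ * ε * (m₀ * w) := by rw [hmw]
          _ = _ := by group
      rw [key]
      exact mul_mul_mem_coe_mul_of_normal hm₀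
        ((normal_charOpenCore p d₁).conj_mem' _ ((charOpenCore (Grp p) d₁).inv_mem hc) _) hw
  · -- (iv)
    intro hm
    rcases Nat.lt_or_ge t τ with ht | ht
    · exact absurd (hW₄' t ε _ ⟨l, hl, rfl⟩
        (Set.mul_subset_mul_left (fun x hx => (hd_small t ht hx).2) hm)) (Set.notMem_empty ε)
    · obtain ⟨m, hm', w, hw, hmw⟩ := Set.mem_mul.mp (Set.mul_subset_mul_left hd_d₁ hm)
      rw [An_eq_map_A] at hm'
      obtain ⟨m₀, hm₀, rfl⟩ := hm'
      apply hstep1 ε l hl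
      have hc' := hτ t ht m₀
      have key : ε⁻¹ * α p l * ε = (θ p t m₀ * m₀⁻¹) * m₀ * w := by
        have e : ε⁻¹ * α p l * ε = (θ p t).toMonoidHom m₀ * w := hmw.symm
        change ε⁻¹ * α p l * ε = θ p t m₀ * w at e
        rw [e]; group
      rw [key]
      exact mul_mul_mem_coe_mul_of_normal hm₀ hc' hw

/-- The valuation shell `Λ_m = {λ : ‖λ‖ = ‖p^m‖}` of `ℤ_p` is compact and misses `0` — the parameter set of
the engine for the power `c^{p^m}` of the escaping element (the local elements of `ρ_N(c^{p^m})` are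
conjugates of `a^λ`, `v_p(λ) = m`). [cite: MochizukiSemiAnbd2006, Thm 3.7(iv) p.41] -/
theorem isCompact_normShell (m : ℕ) :
    IsCompact {l : Multiplicative ℤ_[p] | ‖Multiplicative.toAdd l‖ = ‖(p : ℤ_[p]) ^ m‖} ∧
      (1 : Multiplicative ℤ_[p]) ∉ {l : Multiplicative ℤ_[p] | ‖Multiplicative.toAdd l‖ = ‖(p : ℤ_[p]) ^ m‖} := by
  refine ⟨IsClosed.isCompact (isClosed_eq (continuous_norm.comp continuous_toAdd) continuous_const), ?_⟩
  intro h
  simp only [Set.mem_setOf_eq, toAdd_one, norm_zero] at h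
  exact (norm_ne_zero_iff.mpr (pow_ne_zero m (Nat.cast_ne_zero.mpr hp.out.ne_zero) : (p : ℤ_[p]) ^ m ≠ 0))
    h.symm

end FreeProPRankTwo

end Literature.AnabelianGeometry.SemiGraphs
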